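import Summits.QuantumFields.YangMills.Theorems.BalabanUVNodesN21ExpChartCoveringRadius

/-!
# N21 (NE7c) · THE SHARP COVERING RADIUS OF THE `SU(N)` EXPONENTIAL CHART FOR EVERY `N`, UPPER HALF:
# every `U ∈ SU(N)` is `expPtSU v` with `‖v‖_HS ≤ ρ_N := 2π·√(⌊N/2⌋⌈N/2⌉/N)` (`= √N·π` for even `N`, `= π·√(N − 1/N)` for
# odd `N`), via the CONTINUOUS MAX-CUT LEMMA `|ι|·Σ t² − (Σ t)² ≤ ⌊|ι|/2⌋·⌈|ι|/2⌉` on the cube `[0,1]^ι`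

Width seat pub-ymgap-dag-n21-w1 (g5; director-ym №197 ∕ HUMAN RULING D-0149), node N21 = NE7c (NOT PRINTED in [Bałaban 1983–89], NOT
proved), lane K3⁸ `SpineGivenEndpointR13SepCoPHV` (stmt-QuantumFields-27366, KEY MAP v2; lineage K3⁷ stmt-QuantumFields-20544),
`--kind proof --supports … --as helper`.  File 32 of the seat's chain — it closes the parenthesis file 27 (`…N21ExpChartCoveringRadius`,
p635199) left open in its own header: «for odd `N` the exact covering radius is `2π·√(⌊N/2⌋⌈N/2⌉/N) = π·√(N − 1/N)` … not pursued»; the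
companion file 33 (`…CoveringRadiusSharpHaar`) reads the constant, shows it is ATTAINED for every `N ≥ 1`, and derives
`Haar (g·exp B̄_S) < 1 ⟺ S < ρ_N`.  THEOREMS ONLY: 0 `def`, 0 `sorry`; count-neutral.  Imports file 27 (hence files 18∕19∕23 and pub-balaban's
chart modules).  NO Theses import.  Restates nothing; cites by name.  The radius is SPELLED OUT as
`2 * π * √((N/2 : ℕ) * (N − N/2 : ℕ) / N)` (natural-number division: `N/2 = ⌊N/2⌋`, `N − N/2 = ⌈N/2⌉`); no definition is introduced.

THE MATHEMATICS ([folklore]; the covering radius `√(a(n+1−a)/(n+1))`, `a = ⌊(n+1)/2⌋`, of the root lattice `A_n` in disguise).  File 27 reduced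
«every `U ∈ SU(N)` has a trace-free logarithm of small Hilbert–Schmidt norm» to a lattice statement: the normalised principal angles
`x ∈ [−½, ½]^N`, `Σ x = m ∈ ℤ`, can be shifted by integers to `y = x + n` with `Σ y = 0` and ALL GAPS `y_i − y_j ≤ 1`
(`exists_shift_gaps_le_one`), and then bounded `Σ y² ≤ N/4` by the interval lemma — sharp only for even `N`.  The sharp bound is the
CONTINUOUS MAX-CUT LEMMA (§1): for `t ∈ [0,1]^n`, `n·Σ t² − (Σ t)² = Σ_{i<j} (t_i − t_j)² ≤ ⌊n/2⌋·⌈n/2⌉` — the quadratic is convex in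
each coordinate separately (leading coefficient `n − 1 ≥ 0`), so it lies below the chord between the two neighbouring points with that
coordinate pushed to `0` and to `1`; Finset-induction on the coordinates not yet in `{0,1}` reduces to a vertex `t ∈ {0,1}^n`, where the
quadratic counts the edges of `K_n` across the cut `{t = 1} ∣ {t = 0}`: `a(n − a) ≤ ⌊n/2⌋⌈n/2⌉`.  Applied to `t = y − min y` (translation
does not change `n·Σ y² − (Σ y)²`, and `Σ y = 0`) it gives `Σ y² ≤ ⌊N/2⌋⌈N/2⌉/N`, whence (§2) `‖v‖² = 4π²·Σ y² ≤ ρ_N²` along file 27's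
diagonalisation.

WHAT IS PROVED ([folklore]).
* §1 `nat_mul_sub_le_half_mul` (`a(n−a) ≤ ⌊n/2⌋⌈n/2⌉` in `ℕ`) · `card_mul_sum_sq_sub_sq_sum_le_of_vertex` (`t ∈ {0,1}^ι`) ·
  ★ `card_mul_sum_sq_sub_sq_sum_le` (`t ∈ [0,1]^ι ⇒ |ι|·Σ t² − (Σ t)² ≤ ⌊|ι|/2⌋⌈|ι|/2⌉`) ·
  ★ `sum_sq_le_of_gaps_le_one` (all gaps `≤ 1`, `Σ y = 0 ⇒ Σ y² ≤ ⌊N/2⌋⌈N/2⌉/N`; file 27's interval lemma: `N/4`).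
* §2 `exists_int_shift_sum_zero_gaps_le_one` (file 27's shift for both signs of `m`, BY NAME) · ★ `exists_int_shift_sum_zero_sum_sq_le_sharp` ·
  ★★ `exists_expPtSU_eq_norm_le_coveringRadius` (`∀ U : SU(N), ∃ v, expPtSU v = U ∧ ‖v‖ ≤ ρ_N`; file 27 ★★: `√N·π`) ·
  `expBallSU_eq_univ_of_coveringRadius_le` · `expWindowSU_eq_univ_of_coveringRadius_le` · `haar_expBallSU_eq_one_of_coveringRadius_le`.

HONEST FRAMING.  [folklore] lattice ∕ max-cut bookkeeping BY NAME over pub-balaban's chart modules and files 18∕19∕27; no located letter of any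
N21 road is touched; the application's window radius is a SMALL parameter, so this (with file 33) completes the SHARPNESS record of the chart road
(both radii exact for every `N`) — it is not a new located input; types nothing of Bałaban's; (M1) ∕ NE7c NOT PRINTED ∕ NOT proved; **N21 NOT
discharged**; K3⁸ NOT claimed; counts unmoved (typed 28∕28 · discharged 5∕27); never a count claim; one finite 𝕋⁴ at fixed ε — R4 would close
only the conditional finite-𝕋⁴ rung `BalabanLadder.UV`, NOT the Yang–Mills mass gap (Clay); nothing about ℝ⁴ ∕ OS.  No decl below carries a
cite tag.
-/

set_option autoImplicit false

noncomputable section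

open scoped BigOperators ENNReal
open MeasureTheory Set Function Metric Matrix Finset
open Complex (I)

namespace Summit.QuantumFields.YangMills.Theorems.N21ExpChartCoveringRadiusSharp

open Literature.MathematicalPhysics.QuantumFieldTheory.Balaban1983to89
open Summit.QuantumFields.BalabanUV.T4Continuum
open Summit.QuantumFields.BalabanUV.T4Continuum.ShellMeasureExpChartSUN (SUN ChartSU genSU expPtSU coe_expPtSU)
open Summit.QuantumFields.BalabanUV.T4Continuum.ShellMeasureVandermondeSUN (conjDiag)
open Summit.QuantumFields.BalabanUV.T4Continuum.ShellMeasureExpJacobianSUN (herm exp_genSU_eq_conjDiag norm_sq_eq_sum_sq)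
open Summit.QuantumFields.BalabanUV.T4Continuum.UnitaryResolventMargin (exists_conjDiag_of_unitary)
open Summit.QuantumFields.BalabanUV.T4Continuum.ShellMeasureScalingSUN (expBallSU expWindowSU)
open Summit.QuantumFields.YangMills.Theorems.N21ExpWindowHaarMassLtOne (det_conjDiag)
open Summit.QuantumFields.YangMills.Theorems.N21ExpChartSurjective (cexp_arg_mul_I_of_norm_eq_one exists_herm_eq_conjDiag)
open Summit.QuantumFields.YangMills.Theorems.N21ExpChartCoveringRadius (exists_shift_gaps_le_one)

variable {N : ℕ}

/-! ## §1 The continuous max-cut lemma: `|ι|·Σ t² − (Σ t)² ≤ ⌊|ι|/2⌋·⌈|ι|/2⌉` on the cube `[0,1]^ι` -/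

section MaxCut

/-- the cut count of `K_n`: `a(n − a) ≤ ⌊n/2⌋·⌈n/2⌉` for naturals (`⌈n/2⌉ = n − n/2`; with `n = 2q + r` the difference is
`(a − q)(a − q − r) ≥ 0`). [folklore] -/
theorem nat_mul_sub_le_half_mul (a n : ℕ) : a * (n - a) ≤ (n / 2) * (n - n / 2) := by
  rcases le_or_gt a n with h | h
  · obtain ⟨q, r, hr, hn⟩ : ∃ q r : ℕ, r < 2 ∧ n = 2 * q + r :=
      ⟨n / 2, n % 2, Nat.mod_lt _ two_pos, (Nat.div_add_mod n 2).symm⟩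
    have hq : n / 2 = q := by omega
    have hq' : q ≤ n := by omega
    rw [hq]
    zify [h, hq']
    rw [hn]
    push_cast
    have key : (0 : ℤ) ≤ ((a : ℤ) - q) * ((a : ℤ) - q - r) := by
      interval_cases r
      · rw [Nat.cast_zero, sub_zero]
        exact mul_self_nonneg _
      · rw [Nat.cast_one]
        rcases le_or_gt (a : ℤ) q with haq | haq
        · exact mul_nonneg_of_nonpos_of_nonpos (by linarith) (by linarith)
        · have haq' : (q : ℤ) + 1 ≤ a := Int.add_one_le_iff.mpr haq
          exact mul_nonneg (by linarith) (by linarith)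
    nlinarith [key]
  · rw [Nat.sub_eq_zero_of_le h.le, mul_zero]
    exact Nat.zero_le _

/-- the VERTEX case: for `t ∈ {0,1}^ι` with `a` ones, `|ι|·Σ t² − (Σ t)² = a(|ι| − a) ≤ ⌊|ι|/2⌋·⌈|ι|/2⌉` — the number of edges of the
complete graph across the cut `{t = 1} ∣ {t = 0}`. [folklore] -/
theorem card_mul_sum_sq_sub_sq_sum_le_of_vertex {ι : Type*} [Fintype ι] {t : ι → ℝ} (ht : ∀ i, t i = 0 ∨ t i = 1) :
    (Fintype.card ι : ℝ) * ∑ i, t i ^ 2 - (∑ i, t i) ^ 2 ≤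
      ((Fintype.card ι / 2 : ℕ) : ℝ) * ((Fintype.card ι - Fintype.card ι / 2 : ℕ) : ℝ) := by
  classical
  set n : ℕ := Fintype.card ι with hndef
  set A : Finset ι := univ.filter fun i => t i = 1 with hA
  have hsq : ∑ i, t i ^ 2 = ∑ i, t i :=
    sum_congr rfl fun i _ => by rcases ht i with h | h <;> simp [h]
  have hsum : ∑ i, t i = A.card := by
    have h1 : ∑ i, t i = ∑ i, (if t i = 1 then (1 : ℝ) else 0) :=
      sum_congr rfl fun i _ => by rcases ht i with h | h <;> simp [h]
    rw [h1, sum_boole, hA]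
  have hAn : A.card ≤ n := by rw [hndef]; exact card_le_univ A
  have key : (A.card : ℝ) * ((n : ℝ) - A.card) ≤ ((n / 2 : ℕ) : ℝ) * ((n - n / 2 : ℕ) : ℝ) := by
    have h1 : ((A.card * (n - A.card) : ℕ) : ℝ) ≤ ((n / 2 * (n - n / 2) : ℕ) : ℝ) := by
      exact_mod_cast nat_mul_sub_le_half_mul A.card n
    have h2 : ((A.card * (n - A.card) : ℕ) : ℝ) = (A.card : ℝ) * ((n : ℝ) - A.card) := by
      rw [Nat.cast_mul, Nat.cast_sub hAn]
    have h3 : ((n / 2 * (n - n / 2) : ℕ) : ℝ) = ((n / 2 : ℕ) : ℝ) * ((n - n / 2 : ℕ) : ℝ) := by rw [Nat.cast_mul]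
    rw [← h2, ← h3]
    exact h1
  rw [hsq, hsum]
  calc (n : ℝ) * A.card - (A.card : ℝ) ^ 2 = (A.card : ℝ) * ((n : ℝ) - A.card) := by ring
    _ ≤ _ := key

/-- ★ **THE CONTINUOUS MAX-CUT LEMMA**: for `t ∈ [0,1]^ι`, `|ι|·Σ t² − (Σ t)² ≤ ⌊|ι|/2⌋·⌈|ι|/2⌉`.  Along each coordinate the quadratic
is `x ↦ (|ι| − 1)·x² − 2R₁·x + c`, CONVEX (`|ι| ≥ 1`), so it lies below the chord between its values at `x = 0` and `x = 1`;
Finset-induction on the set of coordinates not yet pushed to `{0,1}` reduces to the vertex case. [folklore] -/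
theorem card_mul_sum_sq_sub_sq_sum_le {ι : Type*} [Fintype ι] {t : ι → ℝ} (ht : ∀ i, 0 ≤ t i ∧ t i ≤ 1) :
    (Fintype.card ι : ℝ) * ∑ i, t i ^ 2 - (∑ i, t i) ^ 2 ≤
      ((Fintype.card ι / 2 : ℕ) : ℝ) * ((Fintype.card ι - Fintype.card ι / 2 : ℕ) : ℝ) := by
  classical
  set n : ℕ := Fintype.card ι with hndef
  set B : ℝ := ((n / 2 : ℕ) : ℝ) * ((n - n / 2 : ℕ) : ℝ) with hBdef
  -- induction on the finset `s` of coordinates still allowed to be fractional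
  suffices h : ∀ s : Finset ι, ∀ u : ι → ℝ, (∀ i, 0 ≤ u i ∧ u i ≤ 1) → (∀ i, i ∉ s → (u i = 0 ∨ u i = 1)) →
      (n : ℝ) * ∑ i, u i ^ 2 - (∑ i, u i) ^ 2 ≤ B from
    h univ t ht fun i hi => absurd (Finset.mem_univ i) hi
  intro s
  induction s using Finset.induction_on with
  | empty => exact fun u _ hu => card_mul_sum_sq_sub_sq_sum_le_of_vertex fun i => hu i (Finset.notMem_empty i)
  | @insert k s hk ih =>
    intro u hu hus
    -- the two neighbouring points with the `k`-th coordinate pushed to `0` and to `1`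
    have hbox : ∀ (x : ℝ), 0 ≤ x → x ≤ 1 → ∀ i, 0 ≤ update u k x i ∧ update u k x i ≤ 1 := fun x hx0 hx1 i => by
      rcases eq_or_ne i k with rfl | hik
      · rw [update_self]; exact ⟨hx0, hx1⟩
      · rw [update_of_ne hik]; exact hu i
    have hvert : ∀ (x : ℝ), (x = 0 ∨ x = 1) → ∀ i, i ∉ s → (update u k x i = 0 ∨ update u k x i = 1) := fun x hx i hi => by
      rcases eq_or_ne i k with rfl | hik
      · rw [update_self]; exact hx
      · rw [update_of_ne hik]
        exact hus i (by rw [Finset.mem_insert, not_or]; exact ⟨hik, hi⟩)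
    have h0 := ih (update u k 0) (hbox 0 le_rfl zero_le_one) (hvert 0 (Or.inl rfl))
    have h1 := ih (update u k 1) (hbox 1 zero_le_one le_rfl) (hvert 1 (Or.inr rfl))
    -- the sums along the `k`-th coordinate line
    set R₁ : ℝ := ∑ i ∈ univ \ {k}, u i with hR₁
    set R₂ : ℝ := ∑ i ∈ univ \ {k}, u i ^ 2 with hR₂
    have hS1 : ∀ x : ℝ, ∑ i, update u k x i = x + R₁ := fun x => sum_update_of_mem (mem_univ k) u x
    have hS2 : ∀ x : ℝ, ∑ i, update u k x i ^ 2 = x ^ 2 + R₂ := fun x => by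
      have h2 : ∀ i, update u k x i ^ 2 = update (fun j => u j ^ 2) k (x ^ 2) i := fun i => by
        rcases eq_or_ne i k with rfl | hik
        · rw [update_self, update_self]
        · rw [update_of_ne hik, update_of_ne hik]
      rw [sum_congr rfl fun i _ => h2 i]
      exact sum_update_of_mem (mem_univ k) _ _
    rw [hS1, hS2] at h0 h1
    have hSt1 : ∑ i, u i = u k + R₁ := by simpa only [update_eq_self] using hS1 (u k)
    have hSt2 : ∑ i, u i ^ 2 = u k ^ 2 + R₂ := by simpa only [update_eq_self] using hS2 (u k)
    rw [hSt1, hSt2]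
    -- convexity along the coordinate: `n ≥ 1`
    have hn1 : (1 : ℝ) ≤ n := by
      rw [hndef]; exact_mod_cast Fintype.card_pos_iff.mpr ⟨k⟩
    obtain ⟨hx0, hx1⟩ := hu k
    have hcx : ((n : ℝ) - 1) * (u k ^ 2 - u k) ≤ 0 := by
      have : 0 ≤ ((n : ℝ) - 1) * (u k * (1 - u k)) :=
        mul_nonneg (by linarith) (mul_nonneg hx0 (by linarith))
      nlinarith [this]
    calc (n : ℝ) * (u k ^ 2 + R₂) - (u k + R₁) ^ 2
        = (1 - u k) * ((n : ℝ) * ((0 : ℝ) ^ 2 + R₂) - (0 + R₁) ^ 2)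
          + u k * ((n : ℝ) * ((1 : ℝ) ^ 2 + R₂) - (1 + R₁) ^ 2) + ((n : ℝ) - 1) * (u k ^ 2 - u k) := by ring
      _ ≤ (1 - u k) * B + u k * B + 0 :=
          add_le_add_three (mul_le_mul_of_nonneg_left h0 (by linarith)) (mul_le_mul_of_nonneg_left h1 hx0) hcx
      _ = B := by ring

/-- ★ **GAPS `≤ 1` AND ZERO SUM BOUND THE SUM OF SQUARES BY `⌊N/2⌋⌈N/2⌉/N`** (file 27's interval lemma gave `N/4`; the two agree for
even `N` and differ by `1/(4N)` for odd `N`).  With `t := y − min y ∈ [0,1]^N`: `N·Σ y² = N·Σ y² − (Σ y)² = N·Σ t² − (Σ t)²` (translation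
invariance), and §1's max-cut lemma applies. [folklore] -/
theorem sum_sq_le_of_gaps_le_one {y : Fin N → ℝ} (hgap : ∀ i j, y i - y j ≤ 1) (hsum : ∑ j, y j = 0) :
    ∑ j, y j ^ 2 ≤ ((N / 2 : ℕ) : ℝ) * ((N - N / 2 : ℕ) : ℝ) / N := by
  rcases Nat.eq_zero_or_pos N with hN | hN
  · subst hN; simp
  · haveI : Nonempty (Fin N) := ⟨⟨0, hN⟩⟩
    have hNr : (0 : ℝ) < N := by exact_mod_cast hN
    obtain ⟨j₀, hj₀⟩ := Finite.exists_min y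
    set c : ℝ := y j₀ with hc
    have key := card_mul_sum_sq_sub_sq_sum_le (t := fun j => y j - c)
      (fun j => ⟨sub_nonneg.mpr (hj₀ j), by linarith [hgap j j₀]⟩)
    simp only [Fintype.card_fin] at key
    have h1 : ∑ j, (y j - c) = -(N * c) := by
      rw [sum_sub_distrib, hsum, sum_const, card_univ, Fintype.card_fin, nsmul_eq_mul]; ring
    have h2 : ∑ j, (y j - c) ^ 2 = ∑ j, y j ^ 2 + N * c ^ 2 := by
      calc ∑ j, (y j - c) ^ 2 = ∑ j, (y j ^ 2 - 2 * c * y j + c ^ 2) := sum_congr rfl fun j _ => by ring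
        _ = ∑ j, y j ^ 2 - 2 * c * ∑ j, y j + N * c ^ 2 := by
            rw [sum_add_distrib, sum_sub_distrib, mul_sum, sum_const, card_univ, Fintype.card_fin, nsmul_eq_mul]
        _ = ∑ j, y j ^ 2 + N * c ^ 2 := by rw [hsum, mul_zero, sub_zero]
    rw [h1, h2] at key
    rw [le_div_iff₀ hNr]
    nlinarith [key]

end MaxCut

/-! ## §2 The sharp lattice step and the sharp cover: every `U ∈ SU(N)` is a chart point of norm `≤ ρ_N` -/

section Cover

/-- file 27's SHIFT for both signs of `m`: for `|x_j| ≤ ½` with `Σ x = m ∈ ℤ` there is `n ∈ ℤ^N` with `Σ (x + n) = 0` and ALL GAPS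
`(x_i + n_i) − (x_j + n_j) ≤ 1` (`exists_shift_gaps_le_one` on `x` if `m ≤ 0`, on `−x` if `m > 0`). [folklore] -/
theorem exists_int_shift_sum_zero_gaps_le_one (x : Fin N → ℝ) (hx : ∀ j, |x j| ≤ 1 / 2) {m : ℤ} (hm : ∑ j, x j = m) :
    ∃ n : Fin N → ℤ, ∑ j, (x j + n j) = 0 ∧ ∀ i j, x i + n i - (x j + n j) ≤ 1 := by
  have hmabs : |(m : ℝ)| ≤ N / 2 := by
    rw [← hm]
    calc |∑ j, x j| ≤ ∑ j, |x j| := abs_sum_le_sum_abs _ _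
      _ ≤ ∑ _j : Fin N, (1 / 2 : ℝ) := sum_le_sum fun j _ => hx j
      _ = N / 2 := by rw [sum_const, card_univ, Fintype.card_fin, nsmul_eq_mul]; ring
  have hN0 : (0 : ℝ) ≤ N := Nat.cast_nonneg N
  rcases le_or_gt m 0 with hm0 | hm0
  · -- `m ≤ 0`: add `+1` to the `|m|` smallest coordinates of `x`
    have h4 : (m.natAbs : ℝ) = -(m : ℝ) := by
      rw [Nat.cast_natAbs, Int.cast_abs, abs_of_nonpos (by exact_mod_cast hm0 : (m : ℝ) ≤ 0)]
    have hle : m.natAbs ≤ N := by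
      have h2 : (m.natAbs : ℝ) ≤ N := by
        have := (abs_le.mp hmabs).1
        linarith
      exact_mod_cast h2
    obtain ⟨n, hn, hgap⟩ := exists_shift_gaps_le_one x hx hle
    refine ⟨n, ?_, hgap⟩
    rw [sum_add_distrib, hm, hn]
    linarith
  · -- `m > 0`: add `+1` to the `m` smallest coordinates of `−x`, then negate
    have h1 : ((m.toNat : ℤ) : ℝ) = (m : ℝ) := by rw [Int.toNat_of_nonneg hm0.le]
    have h3 : (m.toNat : ℝ) = (m : ℝ) := by exact_mod_cast h1
    have hle : m.toNat ≤ N := by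
      have h2 : (m.toNat : ℝ) ≤ N := by
        have := (abs_le.mp hmabs).2
        linarith
      exact_mod_cast h2
    obtain ⟨n, hn, hgap⟩ := exists_shift_gaps_le_one (fun j => -x j) (fun j => by rw [abs_neg]; exact hx j) hle
    refine ⟨fun j => -n j, ?_, fun i j => ?_⟩
    · have h5 : ∑ j, (x j + ((-n j : ℤ) : ℝ)) = ∑ j, x j - ∑ j, (n j : ℝ) := by
        rw [← sum_sub_distrib]
        exact sum_congr rfl fun j _ => by rw [Int.cast_neg]; ring
      rw [h5, hm, hn, h3, sub_self]
    · have := hgap j i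
      simp only [Int.cast_neg]
      linarith

/-- ★ **THE SHARP LATTICE STEP**: for `|x_j| ≤ ½` with `Σ x = m ∈ ℤ` there is `n ∈ ℤ^N` with `Σ (x + n) = 0` and
`Σ (x + n)² ≤ ⌊N/2⌋⌈N/2⌉/N` (file 27's ★ `exists_int_shift_sum_zero_sum_sq_le`: `N/4`). [folklore] -/
theorem exists_int_shift_sum_zero_sum_sq_le_sharp (x : Fin N → ℝ) (hx : ∀ j, |x j| ≤ 1 / 2) {m : ℤ} (hm : ∑ j, x j = m) :
    ∃ n : Fin N → ℤ, ∑ j, (x j + n j) = 0 ∧ ∑ j, (x j + n j) ^ 2 ≤ ((N / 2 : ℕ) : ℝ) * ((N - N / 2 : ℕ) : ℝ) / N := by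
  obtain ⟨n, hn0, hgap⟩ := exists_int_shift_sum_zero_gaps_le_one x hx hm
  exact ⟨n, hn0, sum_sq_le_of_gaps_le_one (y := fun j => x j + n j) hgap hn0⟩

/-- ★★ **EVERY ELEMENT OF `SU(N)` IS A CHART POINT OF HILBERT–SCHMIDT NORM `≤ ρ_N = 2π·√(⌊N/2⌋⌈N/2⌉/N)`** (file 27 ★★: `√N·π`; equal for
even `N`, smaller by the factor `√(1 − 1/N²)` for odd `N`).  Diagonalise `U = V·diag(λ)·V*`, `x_j = arg λ_j / 2π ∈ [−½, ½]`, `Σ x = m ∈ ℤ`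
(`det U = 1`); §2's sharp lattice step gives `n ∈ ℤ^N` with `Σ(x+n) = 0`, `Σ(x+n)² ≤ ⌊N/2⌋⌈N/2⌉/N`; the angles `θ' = 2π(x + n)` are trace-free
with `e^{iθ'} = λ` and `Σ θ'² ≤ ρ_N²`. [folklore] -/
theorem exists_expPtSU_eq_norm_le_coveringRadius (U : SUN N) :
    ∃ v : ChartSU N, expPtSU v = U ∧
      ‖v‖ ≤ 2 * Real.pi * Real.sqrt (((N / 2 : ℕ) : ℝ) * ((N - N / 2 : ℕ) : ℝ) / N) := by
  obtain ⟨V, lam, hlam, hW0⟩ := exists_conjDiag_of_unitary (Matrix.mem_specialUnitaryGroup_iff.mp U.2).1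
  have hW : (U : Matrix (Fin N) (Fin N) ℂ) = conjDiag V lam := hW0
  -- principal angles, in units of `2π`
  set θ : Fin N → ℝ := fun j => Complex.arg (lam j) with hθdef
  have hθlam : ∀ j, Complex.exp (θ j * I) = lam j := fun j => cexp_arg_mul_I_of_norm_eq_one (hlam j)
  set x : Fin N → ℝ := fun j => θ j / (2 * Real.pi) with hxdef
  have hx : ∀ j, |x j| ≤ 1 / 2 := fun j => by
    have hθj : |θ j| ≤ Real.pi := Complex.abs_arg_le_pi (lam j)
    show |θ j / (2 * Real.pi)| ≤ 1 / 2
    rw [abs_div, abs_of_pos Real.two_pi_pos, div_le_iff₀ Real.two_pi_pos]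
    linarith
  -- `det U = 1 ⇒ Σ θ = 2π m`
  have hdet : (U : Matrix (Fin N) (Fin N) ℂ).det = 1 := (Matrix.mem_specialUnitaryGroup_iff.mp U.2).2
  have hsum1 : Complex.exp (((∑ j, θ j : ℝ) : ℂ) * I) = 1 := by
    rw [hW, det_conjDiag] at hdet
    rw [Complex.ofReal_sum, sum_mul, Complex.exp_sum]
    calc ∏ j, Complex.exp ((θ j : ℂ) * I) = ∏ j, lam j := prod_congr rfl fun j _ => hθlam j
      _ = 1 := hdet
  obtain ⟨m, hm⟩ := Complex.exp_eq_one_iff.mp hsum1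
  have hsumθ : ∑ j, θ j = m * (2 * Real.pi) := by
    have := congrArg Complex.im hm
    simpa using this
  have hsumx : ∑ j, x j = m := by
    simp only [hxdef]
    rw [← sum_div, hsumθ, mul_div_assoc, div_self Real.two_pi_pos.ne', mul_one]
  -- the sharp lattice step
  obtain ⟨n, hn0, hnsq⟩ := exists_int_shift_sum_zero_sum_sq_le_sharp x hx hsumx
  set θ' : Fin N → ℝ := fun j => 2 * Real.pi * (x j + n j) with hθ'def
  have hsum0 : ∑ j, θ' j = 0 := by
    simp only [hθ'def]; rw [← mul_sum, hn0, mul_zero]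
  have hθ'lam : ∀ j, Complex.exp (θ' j * I) = lam j := by
    intro j
    have h2 : 2 * Real.pi * (θ j / (2 * Real.pi)) = θ j := mul_div_cancel₀ _ Real.two_pi_pos.ne'
    have h0 : θ' j = θ j + n j * (2 * Real.pi) := by
      show 2 * Real.pi * (θ j / (2 * Real.pi) + n j) = θ j + n j * (2 * Real.pi)
      rw [mul_add, h2]; ring
    have h1 : (θ' j : ℂ) * I = θ j * I + n j * (2 * Real.pi * I) := by
      rw [h0]; push_cast; ring
    rw [h1, Complex.exp_add, Complex.exp_int_mul_two_pi_mul_I, mul_one, hθlam]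
  obtain ⟨v, hherm⟩ := exists_herm_eq_conjDiag V θ' hsum0
  refine ⟨v, ?_, ?_⟩
  · apply Subtype.ext
    rw [coe_expPtSU, exp_genSU_eq_conjDiag hherm, hW]
    congr 1
    funext j
    exact hθ'lam j
  · set B : ℝ := ((N / 2 : ℕ) : ℝ) * ((N - N / 2 : ℕ) : ℝ) / N with hBdef
    have hB0 : 0 ≤ B := by positivity
    have hsq : ‖v‖ ^ 2 = (2 * Real.pi) ^ 2 * ∑ j, (x j + n j) ^ 2 := by
      rw [norm_sq_eq_sum_sq hherm, mul_sum]
      exact sum_congr rfl fun j _ => by simp only [hθ'def]; ring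
    have hsq' : ‖v‖ ^ 2 ≤ (2 * Real.pi) ^ 2 * B := by
      rw [hsq]; exact mul_le_mul_of_nonneg_left hnsq (sq_nonneg _)
    calc ‖v‖ = Real.sqrt (‖v‖ ^ 2) := (Real.sqrt_sq (norm_nonneg v)).symm
      _ ≤ Real.sqrt ((2 * Real.pi) ^ 2 * B) := Real.sqrt_le_sqrt hsq'
      _ = 2 * Real.pi * Real.sqrt B := by
          rw [Real.sqrt_mul (sq_nonneg _), Real.sqrt_sq (by positivity)]

/-- **THE WINDOW OF RADIUS `≥ ρ_N` IS THE WHOLE GROUP** (file 27: radius `√N·π`). [folklore] -/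
theorem expBallSU_eq_univ_of_coveringRadius_le {S : ℝ}
    (hS : 2 * Real.pi * Real.sqrt (((N / 2 : ℕ) : ℝ) * ((N - N / 2 : ℕ) : ℝ) / N) ≤ S) :
    expBallSU (N := N) S = univ :=
  eq_univ_of_forall fun U => by
    obtain ⟨v, hv, hle⟩ := exists_expPtSU_eq_norm_le_coveringRadius U
    exact ⟨v, mem_closedBall_zero_iff.mpr (hle.trans hS), hv⟩

/-- … about every centre. [folklore] -/
theorem expWindowSU_eq_univ_of_coveringRadius_le (g : SUN N) {S : ℝ}
    (hS : 2 * Real.pi * Real.sqrt (((N / 2 : ℕ) : ℝ) * ((N - N / 2 : ℕ) : ℝ) / N) ≤ S) :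
    expWindowSU g S = univ := by
  rw [expWindowSU, expBallSU_eq_univ_of_coveringRadius_le hS, image_univ]
  exact (Group.mulLeft_bijective g).surjective.range_eq

variable [NeZero N] in
/-- … so its Haar mass is `1`. [folklore] -/
theorem haar_expBallSU_eq_one_of_coveringRadius_le {S : ℝ}
    (hS : 2 * Real.pi * Real.sqrt (((N / 2 : ℕ) : ℝ) * ((N - N / 2 : ℕ) : ℝ) / N) ≤ S) :
    (HaarData.haar : Measure (SUN N)) (expBallSU S) = 1 := by
  haveI : IsProbabilityMeasure (HaarData.haar : Measure (SUN N)) := HaarData.isProb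
  rw [expBallSU_eq_univ_of_coveringRadius_le hS, measure_univ]


end Cover

end Summit.QuantumFields.YangMills.Theorems.N21ExpChartCoveringRadiusSharp

end
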